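import Summits.BirchSwinnertonDyer.Rank1Residual.X4.KimShaLengthFiveLe
import HarnessLib

/-!
# The `p ≥ 5` slice of the X4 ∧ `r_an = 0` END STATE with Kim's clause (6) DISCHARGED: "missing output on
# every X4 ∧ r0 ∧ surj ∧ p ≥ 5 pair" ⟺ Kim's Conjecture 1.10 on the conductor-level datum rows ∧ the
# datum-less residue (cell `b2b-bsdres`, seat additive-p4 gen 17, line V30 part 2; sibling of
# `X4/KimShaLengthFiveLe.lean`; CLASS-CLOSURE §3.2 N10 ∩ X4 at `p ≥ 5` / TAM-DEFECT₂ rows)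

HONEST FRAMING (cell `b2b-bsdres`, run/shared/lean/b2b/bsd-rank1-residual/, verbatim in every
file): the goal of the cell is to DELETE the COMBINATION-SHAPED residual classes of the
Birch–Swinnerton-Dyer formula for ALL analytic-rank `≤ 1` elliptic curves over `ℚ` — "full BSD
formula for every rank `≤ 1` curve in class `C`" assembled STRICTLY from published theorems — so
that the rank-`≤ 1` remainder becomes exactly the CONSTRUCTION-SHAPED classes, which are TYPED
(missing-input `Prop`s), NOT attempted. This is not "finishing BSD". Sub-cell additive-p4 (X3♯/X4♯
direct): research route on the CONSTRUCTION-SHAPED class X4; a REDUCTION of the `p ≥ 5` slice of the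
typed conjecture `X4SharpUnitFree` to Kim's printed Conjecture 1.10 per pair, not a proof of either;
the label X4 and the marks of RESIDUAL-MAP §I N10/N11 are UNCHANGED; nothing is booked. Theorems only
(no definition, no named fact minted). Published inputs are explicit named-fact HYPOTHESES: `hKimk` =
`Kim2026.rankZero_le_padicValNat_sha_of_kuriharaNumber_ne_zero` (flag `Kim-(6)-partial-reading`),
`hE67c` = `Kim2026.rankZero_padicValNat_sha_add_le_of_forall_pow_dvd_kuriharaNumber_cyclicLevel` (flag
`Kim2026-(6)-cyclic-reading`; the cell referee rules which reading of Kim's `𝒩_k` is of record),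
GZK `hGZK`, modularity `hmod`. Kim's Conjecture 1.10 enters only as n1011-p12's typed PREDICATE
`X4.KimTamagawaDefectAt` on the right-hand side of an iff — never assumed.

## What this file proves

* §2b (one-liners over the sibling's iffs): `X4.kimTamagawaDefectAt_of_missingPPartAt_of_kimFacts_of_five_le`
  (Conjecture 1.10 is a THEOREM on every CLOSED row at `p ≥ 5` — the E1 calibration set) and
  `X4.kimTamagawaDefectLeAt_of_shaAn_val_nonpos_of_kimFacts_of_five_le` /
  `X4.exists_kuriharaNumber_ne_zero_of_shaAn_val_nonpos_of_kimFacts_of_five_le` (on the `p ∤ #Ш_an`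
  rows the `≤` half holds, i.e. a NON-ZERO cyclic Kurihara number of level `≤ ord_p ∏c + 1` EXISTS —
  the instrument-facing prediction; on TAM-DEFECT₂ rows the missing input is exactly the `≥` half).

* `X4.missingPPartAt_iff_forall_kimTamagawaDefectAt_of_kimFacts_of_five_le` — per row at `p ≥ 5`
  (analytic rank `0`, `ρ̄` onto), datum quantified: the missing output `Typed.MissingPPartAt W p` holds
  iff [Conjecture 1.10 holds for every conductor-level admissible datum (`W.conductorNorm ℤ = N`,
  `p ∤ c_D`, period transfer `Ω(W) = u·Ω⁺_{D.f}`, `|u|_p = 1`) AND, if the row admits no such datum,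
  the missing output holds] — the sibling's per-datum iff, bookkept.
* `X4.x4RankZero_fiveLe_iff_kimTamagawaDefect_of_kimFacts` — the CLASS-LEVEL `p ≥ 5` slice of gen
  16's `Additive.x4SharpUnitFree_iff_kimTamagawaDefect_of_kimShaLength` with (6) no longer a
  hypothesis: "∀ X4 ∧ `r_an = 0` ∧ surj(p) ∧ `p ≥ 5` pairs, `MissingPPartAt`" ⟺ (i) Conjecture 1.10
  on every such pair and conductor-level admissible datum ∧ (ii) `MissingPPartAt` on the pairs with
  no such datum. So at `p ≥ 5` the residue of X4 ∧ `r_an = 0` ∧ surj (N10 ∩ X4, the TAM-DEFECT₂ rows)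
  IS Kim's printed conjecture on the datum rows plus the datum-less rows — named per pair with an
  iff, from published inputs (modulo the two reading flags). `p = 3` (N11) is NOT touched here.

References: C.-H. Kim, Amer. J. Math. 148 (2026) 79–129 = arXiv:2203.12159v4 [Kim2022StructureSelmer]
Thm. 1.9 (6), Conj. 1.10, §1.5.1, Thm. 2.1/§2.2.3; Miller, LMS J. Comput. Math. 14 (2011) Def. 1.1
[Miller2011LMS]; CLASS-CLOSURE-PLAN.md §3.1/§3.2; HOME/b2b-bsdres-additive-p4/README §20.
-/

noncomputable section

open scoped Classical MatrixGroups ModularForm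

open CongruenceSubgroup WeierstrassCurve Literature.NumberTheory.EllipticCurves
  Literature.NumberTheory.EllipticCurves.ModularForms
  Literature.NumberTheory.EllipticCurves.Rank1Residual
  Literature.NumberTheory.EllipticCurves.Rank1Residual.Typed

namespace Summit.BirchSwinnertonDyer.Rank1Residual.X4


/-! ### §2b Two one-line uses of the sibling's iffs: Conjecture 1.10 on CLOSED rows (E1 calibration
set) and the `≤` half — hence a bounded-level NON-ZERO Kurihara number — on the `p ∤ #Ш_an` rows (E4) -/

section Calibration

variable (W : WeierstrassCurve ℚ) [W.IsElliptic] [W.IsGloballyMinimal] (p : ℕ) [Fact p.Prime]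

/-- **On every CLOSED row Kim's Conjecture 1.10 is a theorem (at `p ≥ 5`)**: analytic rank `0`, `ρ̄`
onto, conductor-level admissible datum, and the missing output `Typed.MissingPPartAt W p` of record
(by ANY route: certificate, twist/isogeny transport, unit rows) ⟹ `X4.KimTamagawaDefectAt W p D.f`.
The CLASS-CLOSURE E1 calibration set for any fit of `∂^{(∞)}`: the closed rows, where the answer is
now a kernel statement. [cite: Kim2022StructureSelmer, Thm. 1.9 (6) and Conj. 1.10 (PDF p. 8)] -/
theorem kimTamagawaDefectAt_of_missingPPartAt_of_kimFacts_of_five_le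
    (hKimk : Kim2026.rankZero_le_padicValNat_sha_of_kuriharaNumber_ne_zero)
    (hE67c : Kim2026.rankZero_padicValNat_sha_add_le_of_forall_pow_dvd_kuriharaNumber_cyclicLevel)
    (hGZK : rank_eq_analyticRank_of_analyticRank_le_one) (hmod : hasEntireLFunction_rat)
    (hp : 5 ≤ p) (hr : W.analyticRank = 0) (hsurj : W.HasSurjectiveModNGaloisRep p)
    {N : ℕ} [NeZero N] (D : ModularParametrizationData W N) (hN : W.conductorNorm ℤ = N)
    (hc : ¬ (p : ℤ) ∣ D.maninConstant)
    (hper : ∃ u : ℚ, ‖(u : ℚ_[p])‖ = 1 ∧ W.realPeriodRat = u * plusPeriod D.f)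
    (h : MissingPPartAt W p) : KimTamagawaDefectAt W p D.f :=
  (missingPPartAt_iff_kimTamagawaDefectAt_of_kimFacts_of_five_le W p hKimk hE67c hGZK hmod hp hr hsurj
    D hN hc hper).mp h

/-- **On the `p ∤ #Ш_an` rows the `≤` half of Conjecture 1.10 is a theorem (at `p ≥ 5`)**: if
`#Ш_an = q'` with `ord_p q' ≤ 0` then the LOWER half `ord_p #Ш_an ≤ ord_p #Ш` is trivial, so
`∂^{(∞)}(δ̃) ≤ ord_p ∏_v c_v` by the sibling's iff. (On the TAM-DEFECT₂ rows — `p ∣ ∏c`, `p ∤ #Ш_an` —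
the missing input is therefore EXACTLY the `≥` half.)
[cite: Kim2022StructureSelmer, Thm. 1.9 (6) and Conj. 1.10 (PDF p. 8)] [cite: Miller2011LMS, Def. 1.1] -/
theorem kimTamagawaDefectLeAt_of_shaAn_val_nonpos_of_kimFacts_of_five_le
    (hKimk : Kim2026.rankZero_le_padicValNat_sha_of_kuriharaNumber_ne_zero)
    (hE67c : Kim2026.rankZero_padicValNat_sha_add_le_of_forall_pow_dvd_kuriharaNumber_cyclicLevel)
    (hGZK : rank_eq_analyticRank_of_analyticRank_le_one) (hmod : hasEntireLFunction_rat)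
    (hp : 5 ≤ p) (hr : W.analyticRank = 0) (hsurj : W.HasSurjectiveModNGaloisRep p)
    {N : ℕ} [NeZero N] (D : ModularParametrizationData W N) (hN : W.conductorNorm ℤ = N)
    (hc : ¬ (p : ℤ) ∣ D.maninConstant)
    (hper : ∃ u : ℚ, ‖(u : ℚ_[p])‖ = 1 ∧ W.realPeriodRat = u * plusPeriod D.f)
    (hsha : ∃ q' : ℚ, shaAn W = (q' : ℂ) ∧ padicValRat p q' ≤ 0) :
    KimTamagawaDefectLeAt W p D.f := by
  obtain ⟨q', hq', hv⟩ := hsha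
  exact (missingLowerBoundAt_iff_kimTamagawaDefectLeAt_of_kimFacts_of_five_le W p hKimk hE67c hGZK
    hmod hp hr hsurj D hN hc hper).mp ⟨q', hq', hv.trans (by positivity)⟩

/-- **… so every such row carries a NON-ZERO Kurihara number at a cyclic level `n ∈ 𝒩_k` with
`1 ≤ k ≤ ord_p ∏_v c_v + 1`** (n1011-p12's unwinding `exists_certificate_of_kuriharaPartialInfty_le`):
the kernel form of the instrument-facing PREDICTION for the Kurihara-number engine on the X4 ∧
`r_an = 0` ∧ surj ∧ `p ≥ 5` ∧ `p ∤ #Ш_an` rows (TAM-DEFECT₂ included) — an existence statement,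
confirmable per pair by exhibiting the level. EVIDENCE use only; nothing booked.
[cite: Kim2022StructureSelmer, Thm. 1.9 (6), Conj. 1.10 and §1.5.1 (PDF pp. 7–8)] -/
theorem exists_kuriharaNumber_ne_zero_of_shaAn_val_nonpos_of_kimFacts_of_five_le
    (hKimk : Kim2026.rankZero_le_padicValNat_sha_of_kuriharaNumber_ne_zero)
    (hE67c : Kim2026.rankZero_padicValNat_sha_add_le_of_forall_pow_dvd_kuriharaNumber_cyclicLevel)
    (hGZK : rank_eq_analyticRank_of_analyticRank_le_one) (hmod : hasEntireLFunction_rat)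
    (hp : 5 ≤ p) (hr : W.analyticRank = 0) (hsurj : W.HasSurjectiveModNGaloisRep p)
    {N : ℕ} [NeZero N] (D : ModularParametrizationData W N) (hN : W.conductorNorm ℤ = N)
    (hc : ¬ (p : ℤ) ∣ D.maninConstant)
    (hper : ∃ u : ℚ, ‖(u : ℚ_[p])‖ = 1 ∧ W.realPeriodRat = u * plusPeriod D.f)
    (hsha : ∃ q' : ℚ, shaAn W = (q' : ℂ) ∧ padicValRat p q' ≤ 0) :
    ∃ (n k : ℕ) (hk : Kato.IsKolyvaginProduct W p k n), IsCyclicKolyvaginLevel W p n ∧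
      1 ≤ k ∧ k ≤ padicValNat p W.tamagawaProduct + 1 ∧
      ∃ ψ : (ℓ : ℕ) → (ZMod ℓ)ˣ →* Multiplicative (ZMod (p ^ k)),
        (∀ ℓ ∈ n.primeFactors, Function.Surjective (ψ ℓ)) ∧
        (haveI : NeZero n := ⟨hk.ne_zero⟩; kuriharaNumber D.f (p ^ k) n ψ ≠ 0) :=
  exists_certificate_of_kuriharaPartialInfty_le W p D.f
    (kimTamagawaDefectLeAt_of_shaAn_val_nonpos_of_kimFacts_of_five_le W p hKimk hE67c hGZK hmod hp hr
      hsurj D hN hc hper hsha)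

end Calibration

/-! ### §3 The `p ≥ 5` slice of the X4 ∧ `r_an = 0` end state, with (6) discharged -/

section EndState

variable (W : WeierstrassCurve ℚ) [W.IsElliptic] [W.IsGloballyMinimal] (p : ℕ) [Fact p.Prime]

/-- **Per row at `p ≥ 5`, datum quantified, fact-only**: the missing output holds iff [Conjecture 1.10
holds for every conductor-level admissible datum AND (if the row admits none) the missing output
holds]. gen 16's `X4RankZero.missingPPartAt_iff_forall_kimTamagawaDefectAt_of_kimShaLength` with (6)
discharged by §1; "admissible" now includes `W.conductorNorm ℤ = N`.
[cite: Kim2022StructureSelmer, Thm. 1.9 (6) and Conj. 1.10 (PDF p. 8)] [cite: Miller2011LMS, Def. 1.1] -/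
theorem missingPPartAt_iff_forall_kimTamagawaDefectAt_of_kimFacts_of_five_le
    (hKimk : Kim2026.rankZero_le_padicValNat_sha_of_kuriharaNumber_ne_zero)
    (hE67c : Kim2026.rankZero_padicValNat_sha_add_le_of_forall_pow_dvd_kuriharaNumber_cyclicLevel)
    (hGZK : rank_eq_analyticRank_of_analyticRank_le_one) (hmod : hasEntireLFunction_rat)
    (hp : 5 ≤ p) (hr : W.analyticRank = 0) (hsurj : W.HasSurjectiveModNGaloisRep p) :
    MissingPPartAt W p ↔
      ((∀ {N : ℕ} [NeZero N] (D : ModularParametrizationData W N), W.conductorNorm ℤ = N →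
          ¬ (p : ℤ) ∣ D.maninConstant →
          (∃ u : ℚ, ‖(u : ℚ_[p])‖ = 1 ∧ W.realPeriodRat = u * plusPeriod D.f) →
          KimTamagawaDefectAt W p D.f) ∧
        ((∀ (N : ℕ) [NeZero N] (D : ModularParametrizationData W N), W.conductorNorm ℤ ≠ N ∨
            (p : ℤ) ∣ D.maninConstant ∨
            ¬ ∃ u : ℚ, ‖(u : ℚ_[p])‖ = 1 ∧ W.realPeriodRat = u * plusPeriod D.f) →
          MissingPPartAt W p)) := by
  constructor
  · intro h
    exact ⟨fun D hN hc hper ↦ (missingPPartAt_iff_kimTamagawaDefectAt_of_kimFacts_of_five_le W p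
      hKimk hE67c hGZK hmod hp hr hsurj D hN hc hper).mp h, fun _ ↦ h⟩
  · rintro ⟨hconj, hres⟩
    by_cases hD : ∃ (N : ℕ) (_ : NeZero N) (D : ModularParametrizationData W N),
        W.conductorNorm ℤ = N ∧ ¬ (p : ℤ) ∣ D.maninConstant ∧
          ∃ u : ℚ, ‖(u : ℚ_[p])‖ = 1 ∧ W.realPeriodRat = u * plusPeriod D.f
    · obtain ⟨N, hNz, D, hN, hc, hper⟩ := hD
      exact (missingPPartAt_iff_kimTamagawaDefectAt_of_kimFacts_of_five_le W p hKimk hE67c hGZK hmod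
        hp hr hsurj D hN hc hper).mpr (hconj D hN hc hper)
    · refine hres fun N _ D ↦ ?_
      by_contra hnot
      simp only [not_or, not_not] at hnot
      exact hD ⟨N, inferInstance, D, hnot.1, hnot.2.1, hnot.2.2⟩

/-- **The `p ≥ 5` slice of X4♯(unit-free), END STATE with (6) DISCHARGED**: "the missing output on
every X4 ∧ `r_an = 0` ∧ surj(p) ∧ `p ≥ 5` pair" ⟺ (i) Kim's Conjecture 1.10
(`X4.KimTamagawaDefectAt W p D.f`, `∂^{(∞)}(δ̃) = ord_p ∏_v c_v`) on every such pair for every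
conductor-level admissible datum (`W.conductorNorm ℤ = N`, `p ∤ c_D`, period transfer) ∧ (ii) the
missing output on the pairs admitting NO such datum. Inputs: the two Kim facts (flags inherited),
GZK, modularity — nothing open assumed. So at `p ≥ 5` the residue of X4 ∧ `r_an = 0` ∧ surj (N10 ∩ X4
and the TAM-DEFECT₂ rows) IS Kim's printed Conjecture 1.10 on the datum rows plus the datum-less
rows, per pair with an iff. X4 stays CONSTRUCTION-SHAPED; no mark moves; nothing booked.
[cite: Kim2022StructureSelmer, Thm. 1.9 (6) and Conj. 1.10 (PDF p. 8)] [cite: Miller2011LMS, §1 and Def. 1.1] -/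
theorem x4RankZero_fiveLe_iff_kimTamagawaDefect_of_kimFacts
    (hKimk : Kim2026.rankZero_le_padicValNat_sha_of_kuriharaNumber_ne_zero)
    (hE67c : Kim2026.rankZero_padicValNat_sha_add_le_of_forall_pow_dvd_kuriharaNumber_cyclicLevel)
    (hGZK : rank_eq_analyticRank_of_analyticRank_le_one) (hmod : hasEntireLFunction_rat) :
    (∀ (W : WeierstrassCurve ℚ) [W.IsElliptic] [W.IsGloballyMinimal] (p : ℕ) [Fact p.Prime],
        5 ≤ p → W.analyticRank = 0 → ClassX4 W p → Surj W p → MissingPPartAt W p) ↔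
      (∀ (W : WeierstrassCurve ℚ) [W.IsElliptic] [W.IsGloballyMinimal] (p : ℕ) [Fact p.Prime],
          5 ≤ p → W.analyticRank = 0 → ClassX4 W p → Surj W p →
          ∀ {N : ℕ} [NeZero N] (D : ModularParametrizationData W N), W.conductorNorm ℤ = N →
          ¬ (p : ℤ) ∣ D.maninConstant →
          (∃ u : ℚ, ‖(u : ℚ_[p])‖ = 1 ∧ W.realPeriodRat = u * plusPeriod D.f) →
          KimTamagawaDefectAt W p D.f) ∧
      (∀ (W : WeierstrassCurve ℚ) [W.IsElliptic] [W.IsGloballyMinimal] (p : ℕ) [Fact p.Prime],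
          5 ≤ p → W.analyticRank = 0 → ClassX4 W p → Surj W p →
          (∀ (N : ℕ) [NeZero N] (D : ModularParametrizationData W N), W.conductorNorm ℤ ≠ N ∨
            (p : ℤ) ∣ D.maninConstant ∨
            ¬ ∃ u : ℚ, ‖(u : ℚ_[p])‖ = 1 ∧ W.realPeriodRat = u * plusPeriod D.f) →
          MissingPPartAt W p) := by
  constructor
  · intro hX4
    refine ⟨fun W _ _ p _ hp hr hX hs N _ D hN hc hper ↦ ?_,
      fun W _ _ p _ hp hr hX hs _ ↦ hX4 W p hp hr hX hs⟩
    exact ((missingPPartAt_iff_forall_kimTamagawaDefectAt_of_kimFacts_of_five_le W p hKimk hE67c hGZK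
      hmod hp hr hs).mp (hX4 W p hp hr hX hs)).1 D hN hc hper
  · rintro ⟨hconj, hres⟩ W _ _ p _ hp hr hX hs
    exact (missingPPartAt_iff_forall_kimTamagawaDefectAt_of_kimFacts_of_five_le W p hKimk hE67c hGZK
      hmod hp hr hs).mpr ⟨fun D hN hc hper ↦ hconj W p hp hr hX hs D hN hc hper, hres W p hp hr hX hs⟩

end EndState

end Summit.BirchSwinnertonDyer.Rank1Residual.X4

end
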